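import Mathlib.Analysis.CStarAlgebra.Matrix
import Literature.MathematicalPhysics.QuantumLattice.OverlapLocality
import Literature.MathematicalPhysics.QuantumLattice.LatticeToriProofs

/-!
# Finite range and uniform row sums of the Wilson–Dirac operator
(helpers for `DaviesGaffneyWilson`, stmt-QuantumFields-8873, route `QuantumFields/QCD/HeatSlicedQuarks`)

For the tree's Wilson–Dirac matrix `D = wilsonDirac ρ U m r` on the four-torus `(ℤ/L)⁴`
(index `TorusSite 4 L × Fin N × Fin 4`), with `ρ` a representation by unitary matrices:

* `wilsonDirac_apply_eq_zero` — nearest-neighbour coupling: `D_{pq} = 0` when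
  `torusDist p.1 q.1 > 1`;
* `norm_wilsonDirac_apply_le` — an entrywise bound by indicator functions, with constants
  independent of the gauge field (`|ρ(U)_{ab}| ≤ 1` for unitary `ρ(U)`, `|(γ_μ)_{αβ}| ≤ 1`);
* `sum_norm_wilsonDirac_row_le`, `sum_norm_wilsonDirac_col_le` — row and column sums of `|D|`
  are at most `|m + 4r| + 16 N (|r| + 1)`;
* `conjTranspose_mul_wilsonDirac_apply_eq_zero`, `sum_norm_conjTranspose_mul_wilsonDirac_le` —
  hence `H = D† D` couples only sites at torus distance `≤ 2` and has row sums of `|H|` at most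
  `(|m + 4r| + 16 N (|r| + 1))²`, uniformly in the gauge field.

No named facts are used.
-/

noncomputable section

namespace Summit.QuantumFields.QCD.Theorems.HeatSlicedQuarksDaviesGaffney

open Matrix Finset
open Literature.Probability.LatticeModels (TorusSite)
open Literature.MathematicalPhysics.QuantumFieldTheory
open Literature.MathematicalPhysics.QuantumLattice

/-! ### Torus distance of a unit shift -/

section Torus

variable {d L : ℕ} [NeZero L]

/-- A unit shift moves a site by torus distance at most `1`: `dist(x + μ̂, x) ≤ 1`. -/
theorem torusDist_shift_self_le (x : TorusSite d L) (μ : Fin d) :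
    torusDist (Site.shift x μ) x ≤ 1 := by
  unfold torusDist
  rw [Site.shift, add_sub_cancel_left]
  simp only [torusNorm]
  refine Finset.sup_le fun j _ => ?_
  rcases eq_or_ne j μ with rfl | hj
  · rw [Pi.single_eq_same]; exact cyclicAbs_one_le
  · rw [Pi.single_eq_of_ne hj]; simp

/-- A unit shift moves a site by torus distance at most `1`: `dist(x, x + μ̂) ≤ 1`. -/
theorem torusDist_self_shift_le (x : TorusSite d L) (μ : Fin d) :
    torusDist x (Site.shift x μ) ≤ 1 := by
  rw [torusDist_comm']
  exact torusDist_shift_self_le x μ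

end Torus

/-! ### Entries of the Wilson–Dirac operator -/

section Wilson

variable {L N : ℕ} {G : Type*} [Group G] (ρ : G →* Matrix (Fin N) (Fin N) ℂ)

/-- The Euclidean gamma matrices are unitary (`γ_μ† = γ_μ`, `γ_μ² = 1`). -/
theorem euclideanGamma_mem_unitaryGroup (μ : Fin 4) :
    euclideanGamma μ ∈ Matrix.unitaryGroup (Fin 4) ℂ := by
  rw [Matrix.mem_unitaryGroup_iff, star_eq_conjTranspose, (euclideanGamma_isHermitian μ).eq,
    euclideanGamma_mul_self]

/-- Entries of `γ_μ` have modulus at most `1`. -/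
theorem norm_euclideanGamma_apply_le (μ : Fin 4) (α β : Fin 4) : ‖euclideanGamma μ α β‖ ≤ 1 :=
  entry_norm_bound_of_unitary (euclideanGamma_mem_unitaryGroup μ) α β

/-- Entries of `r·1 ∓ γ_μ` have modulus at most `|r| + 1`. -/
theorem norm_smul_one_sub_gamma_apply_le (r : ℝ) (μ : Fin 4) (α β : Fin 4) :
    ‖((r : ℂ) • (1 : Matrix (Fin 4) (Fin 4) ℂ) - euclideanGamma μ) α β‖ ≤ |r| + 1 := by
  rw [Matrix.sub_apply, Matrix.smul_apply, smul_eq_mul]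
  refine (norm_sub_le _ _).trans (add_le_add ?_ (norm_euclideanGamma_apply_le μ α β))
  rw [norm_mul, Complex.norm_real, Real.norm_eq_abs]
  refine mul_le_of_le_one_right (abs_nonneg r) ?_
  rw [Matrix.one_apply]
  split_ifs <;> simp

/-- Entries of `r·1 + γ_μ` have modulus at most `|r| + 1`. -/
theorem norm_smul_one_add_gamma_apply_le (r : ℝ) (μ : Fin 4) (α β : Fin 4) :
    ‖((r : ℂ) • (1 : Matrix (Fin 4) (Fin 4) ℂ) + euclideanGamma μ) α β‖ ≤ |r| + 1 := by
  rw [Matrix.add_apply, Matrix.smul_apply, smul_eq_mul]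
  refine (norm_add_le _ _).trans (add_le_add ?_ (norm_euclideanGamma_apply_le μ α β))
  rw [norm_mul, Complex.norm_real, Real.norm_eq_abs]
  refine mul_le_of_le_one_right (abs_nonneg r) ?_
  rw [Matrix.one_apply]
  split_ifs <;> simp

variable [NeZero L]

/-- **Nearest-neighbour coupling.**  The Wilson–Dirac matrix couples only equal or neighbouring
sites: `D_{pq} = 0` whenever `torusDist p.1 q.1 > 1`. -/
theorem wilsonDirac_apply_eq_zero (U : GaugeConfig 4 L G) (m r : ℝ)
    (p q : TorusSite 4 L × Fin N × Fin 4) (hpq : 1 < torusDist p.1 q.1) :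
    wilsonDirac ρ U m r p q = 0 := by
  have hne : p ≠ q := by
    rintro rfl
    rw [torusDist_self] at hpq
    exact Nat.not_lt_zero 1 hpq
  have h1 : ∀ μ : Fin 4, q.1 ≠ Site.shift p.1 μ := fun μ h => by
    have := torusDist_self_shift_le p.1 μ
    rw [← h] at this
    omega
  have h2 : ∀ μ : Fin 4, p.1 ≠ Site.shift q.1 μ := fun μ h => by
    have := torusDist_shift_self_le q.1 μ
    rw [← h] at this
    omega
  simp only [wilsonDirac, Matrix.of_apply, if_neg hne, if_neg (h1 _), if_neg (h2 _), add_zero,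
    Finset.sum_const_zero, mul_zero, sub_zero]

/-- Counting: `Σ_{q} [q.1 = s]·c = 4N·c` over `q : TorusSite 4 L × Fin N × Fin 4`. -/
theorem sum_ite_fst_eq (s : TorusSite 4 L) (c : ℝ) :
    ∑ q : TorusSite 4 L × Fin N × Fin 4, (if q.1 = s then c else 0) = 4 * N * c := by
  rw [Fintype.sum_prod_type, Finset.sum_comm]
  simp only [Finset.sum_ite_eq', Finset.mem_univ, if_true]
  simp only [Finset.sum_const, Finset.card_univ, Fintype.card_prod, Fintype.card_fin, nsmul_eq_mul]
  push_cast
  ring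

omit [NeZero L] in
/-- **Entrywise bound, uniform in the gauge field.**  For unitary `ρ`,
`|D_{pq}| ≤ |m+4r|·[p = q] + ½ Σ_μ ((|r|+1)·[q.1 = p.1 + μ̂] + (|r|+1)·[p.1 = q.1 + μ̂])`. -/
theorem norm_wilsonDirac_apply_le (hρ : ∀ g, ρ g ∈ Matrix.unitaryGroup (Fin N) ℂ)
    (U : GaugeConfig 4 L G) (m r : ℝ) (p q : TorusSite 4 L × Fin N × Fin 4) :
    ‖wilsonDirac ρ U m r p q‖ ≤
      (if p = q then |m + 4 * r| else 0) +
        (1 / 2 : ℝ) * ∑ μ : Fin 4, ((if q.1 = Site.shift p.1 μ then |r| + 1 else 0) +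
          (if p.1 = Site.shift q.1 μ then |r| + 1 else 0)) := by
  have hU : ∀ g (a b : Fin N), ‖ρ g a b‖ ≤ 1 := fun g a b =>
    entry_norm_bound_of_unitary (hρ g) a b
  rw [wilsonDirac, Matrix.of_apply]
  refine (norm_sub_le _ _).trans (add_le_add ?_ ?_)
  · split_ifs
    · rw [Complex.norm_real, Real.norm_eq_abs]
    · rw [norm_zero]
  · rw [norm_mul, show ‖(1 / 2 : ℂ)‖ = 1 / 2 by norm_num]
    refine mul_le_mul_of_nonneg_left ((norm_sum_le _ _).trans (Finset.sum_le_sum fun μ _ => ?_))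
      (by norm_num)
    refine (norm_add_le _ _).trans (add_le_add ?_ ?_)
    · split_ifs
      · rw [norm_mul]
        exact mul_le_mul (norm_smul_one_sub_gamma_apply_le r μ _ _) (hU _ _ _) (norm_nonneg _)
          (by positivity) |>.trans (by rw [mul_one])
      · rw [norm_zero]
    · split_ifs
      · rw [norm_mul]
        exact mul_le_mul (norm_smul_one_add_gamma_apply_le r μ _ _) (hU _ _ _) (norm_nonneg _)
          (by positivity) |>.trans (by rw [mul_one])
      · rw [norm_zero]

/-- **Row sums of `|D|`, uniform in the gauge field**: `Σ_q |D_{pq}| ≤ |m + 4r| + 16N(|r|+1)`. -/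
theorem sum_norm_wilsonDirac_row_le (hρ : ∀ g, ρ g ∈ Matrix.unitaryGroup (Fin N) ℂ)
    (U : GaugeConfig 4 L G) (m r : ℝ) (p : TorusSite 4 L × Fin N × Fin 4) :
    ∑ q, ‖wilsonDirac ρ U m r p q‖ ≤ |m + 4 * r| + 16 * N * (|r| + 1) := by
  refine (Finset.sum_le_sum fun q _ => norm_wilsonDirac_apply_le ρ hρ U m r p q).trans ?_
  rw [Finset.sum_add_distrib, Finset.sum_ite_eq Finset.univ p, if_pos (Finset.mem_univ _),
    ← Finset.mul_sum, Finset.sum_comm]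
  simp only [Finset.sum_add_distrib]
  have h1 : ∀ μ : Fin 4, ∑ q : TorusSite 4 L × Fin N × Fin 4,
      (if q.1 = Site.shift p.1 μ then |r| + 1 else 0) = 4 * N * (|r| + 1) := fun μ =>
    sum_ite_fst_eq _ _
  have h2 : ∀ μ : Fin 4, ∑ q : TorusSite 4 L × Fin N × Fin 4,
      (if p.1 = Site.shift q.1 μ then |r| + 1 else 0) = 4 * N * (|r| + 1) := fun μ => by
    simp_rw [eq_shift_iff p.1]
    exact sum_ite_fst_eq _ _
  simp only [h1, h2, Finset.sum_const, Finset.card_univ, Fintype.card_fin]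
  ring_nf
  rfl

/-- **Column sums of `|D|`, uniform in the gauge field**: `Σ_p |D_{pq}| ≤ |m + 4r| + 16N(|r|+1)`. -/
theorem sum_norm_wilsonDirac_col_le (hρ : ∀ g, ρ g ∈ Matrix.unitaryGroup (Fin N) ℂ)
    (U : GaugeConfig 4 L G) (m r : ℝ) (q : TorusSite 4 L × Fin N × Fin 4) :
    ∑ p, ‖wilsonDirac ρ U m r p q‖ ≤ |m + 4 * r| + 16 * N * (|r| + 1) := by
  refine (Finset.sum_le_sum fun p _ => norm_wilsonDirac_apply_le ρ hρ U m r p q).trans ?_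
  rw [Finset.sum_add_distrib, Finset.sum_ite_eq' Finset.univ q, if_pos (Finset.mem_univ _),
    ← Finset.mul_sum, Finset.sum_comm]
  simp only [Finset.sum_add_distrib]
  have h1 : ∀ μ : Fin 4, ∑ p : TorusSite 4 L × Fin N × Fin 4,
      (if q.1 = Site.shift p.1 μ then |r| + 1 else 0) = 4 * N * (|r| + 1) := fun μ => by
    simp_rw [eq_shift_iff q.1]
    exact sum_ite_fst_eq _ _
  have h2 : ∀ μ : Fin 4, ∑ p : TorusSite 4 L × Fin N × Fin 4,
      (if p.1 = Site.shift q.1 μ then |r| + 1 else 0) = 4 * N * (|r| + 1) := fun μ =>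
    sum_ite_fst_eq _ _
  simp only [h1, h2, Finset.sum_const, Finset.card_univ, Fintype.card_fin]
  ring_nf
  rfl

/-! ### The positive operator `H = D† D` -/

/-- **Range two.**  `H = D†D` couples only sites at torus distance `≤ 2`:
`H_{pq} = Σ_k conj(D_{kp}) D_{kq} = 0` when `torusDist p.1 q.1 > 2` (triangle inequality). -/
theorem conjTranspose_mul_wilsonDirac_apply_eq_zero (U : GaugeConfig 4 L G) (m r : ℝ)
    (p q : TorusSite 4 L × Fin N × Fin 4) (hpq : 2 < torusDist p.1 q.1) :
    ((wilsonDirac ρ U m r)ᴴ * wilsonDirac ρ U m r) p q = 0 := by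
  rw [Matrix.mul_apply]
  refine Finset.sum_eq_zero fun k _ => ?_
  rw [Matrix.conjTranspose_apply]
  by_cases hk : 1 < torusDist k.1 p.1
  · rw [wilsonDirac_apply_eq_zero ρ U m r k p hk, star_zero, zero_mul]
  · have hk' : 1 < torusDist k.1 q.1 := by
      have h3 := torusDist_triangle' p.1 k.1 q.1
      rw [torusDist_comm' p.1 k.1] at h3
      omega
    rw [wilsonDirac_apply_eq_zero ρ U m r k q hk', mul_zero]

/-- **Row sums of `|D†D|`, uniform in the gauge field**:
`Σ_q |(D†D)_{pq}| ≤ (|m + 4r| + 16N(|r|+1))²` (column sum times row sum of `|D|`). -/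
theorem sum_norm_conjTranspose_mul_wilsonDirac_le (hρ : ∀ g, ρ g ∈ Matrix.unitaryGroup (Fin N) ℂ)
    (U : GaugeConfig 4 L G) (m r : ℝ) (p : TorusSite 4 L × Fin N × Fin 4) :
    ∑ q, ‖((wilsonDirac ρ U m r)ᴴ * wilsonDirac ρ U m r) p q‖ ≤
      (|m + 4 * r| + 16 * N * (|r| + 1)) ^ 2 := by
  set D := wilsonDirac ρ U m r with hD
  set B : ℝ := |m + 4 * r| + 16 * N * (|r| + 1) with hB
  have hB0 : 0 ≤ B := by positivity
  calc ∑ q, ‖(Dᴴ * D) p q‖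
      ≤ ∑ q, ∑ k, ‖D k p‖ * ‖D k q‖ := by
        refine Finset.sum_le_sum fun q _ => ?_
        rw [Matrix.mul_apply]
        refine (norm_sum_le _ _).trans (Finset.sum_le_sum fun k _ => ?_)
        rw [Matrix.conjTranspose_apply, norm_mul, norm_star]
    _ = ∑ k, ‖D k p‖ * ∑ q, ‖D k q‖ := by
        rw [Finset.sum_comm]
        exact Finset.sum_congr rfl fun k _ => (Finset.mul_sum _ _ _).symm
    _ ≤ ∑ k, ‖D k p‖ * B :=
        Finset.sum_le_sum fun k _ => mul_le_mul_of_nonneg_left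
          (sum_norm_wilsonDirac_row_le ρ hρ U m r k) (norm_nonneg _)
    _ = (∑ k, ‖D k p‖) * B := (Finset.sum_mul _ _ _).symm
    _ ≤ B * B := mul_le_mul_of_nonneg_right (sum_norm_wilsonDirac_col_le ρ hρ U m r p) hB0
    _ = B ^ 2 := (sq B).symm

end Wilson

end Summit.QuantumFields.QCD.Theorems.HeatSlicedQuarksDaviesGaffney
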